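import Literature.MathematicalPhysics.KineticTheory.LinearisedPhononCollisionOperator
import Mathlib.Analysis.Calculus.FDeriv.Mul
import Mathlib.Analysis.Calculus.FDeriv.Prod
import Mathlib.Analysis.Calculus.FDeriv.Pi
import Mathlib.Analysis.Calculus.Deriv.Comp
import Mathlib.Analysis.Complex.RealDeriv
import HarnessLib

/-!
# The second-quantised conjugate operator `dΓ(a_v)` on the `(m,n)`-phonon shells of the harmonic chain

Topic `Literature/MathematicalPhysics/KineticTheory`; definition request
`defn-SecondQuantisedConjugateOperator` (route `EmbeddedDrudeMourre` of
`AtomisticToContinuum/FouriersLaw`, crux `MourreDissolution`, wanted to STATE the layer-2 item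
`OddMourreEstimate`; companion of `defn-HarmonicChaosDecomposition`, not yet in the tree). The
abstract half of the request — the classes `C¹(𝒜)`, `𝒞^{1,1}(𝒜)` and the Mourre estimate for a
self-adjoint `H` relative to a conjugate operator `𝒜`, through unitary groups — is
`Literature/Analysis/UnboundedOperators/ConjugateOperatorRegularity.lean`; this file is the
concrete kinetic-theory half.

## Setting (van Hemmen 1980 §§3–4; ALS06 §3)

In the chaos (second-quantisation) picture of the zero-wavenumber space `ℋ₀(μ₀)` of the infinite
pinned harmonic chain, the `(m,n)` sector consists of symmetric functions `F(k, k')` of `m`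
"unprimed" momenta `k = (k_i) ∈ 𝕋^m` and `n` "primed" momenta `k' = (k'_j) ∈ 𝕋^n` on the
zero-total-momentum shell `Σ k_i - Σ k'_j ≡ 0 (mod 2π)`, the free evolution being multiplication by
`e^{itΩ_{m,n}}`, `Ω_{m,n}(k, k') = Σ_i ω(k_i) - Σ_j ω(k'_j)` with the pinned band
`ω = PhononBoltzmann.dispersion ω₂` (`ω' = groupVelocity ω₂`, `hasDerivAt_dispersion`).
Here momenta are real `2π`-periodic representatives (the convention of
`LinearisedPhononCollisionOperator.lean` / `PinnedChainBoltzmannOperator.lean`): a shell point is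
`p = (k, k') : ShellPoint m n = (Fin m → ℝ) × (Fin n → ℝ)`, functions on `𝕋^m × 𝕋^n` are functions of
`p` that are `2π`-periodic in every coordinate, and all operators below are POINTWISE
differential expressions on such functions (as `MomentumHermiteLadder.lean` does for the ladder
`R`, `R†`), independent of any measure.

## The operator (ABG §7.6, (7.6.14)–(7.6.15) and Prop. 7.6.3 (a); Mourre 1981)

For a vector field `X` on the shell coordinates the CONJUGATE OPERATOR is
`A_X = ½[X·(i∇) + (i∇)·X] = i(X·∇ + ½ div X) = i 𝒜_X` (ABG (7.6.15), written in the variables in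
which the free Hamiltonian `Ω` is a multiplication operator), where
`𝒜_X F = X·∇F + ½ (div X) F` (`symLie`, the symmetrised Lie derivative = skew-symmetric part of
`X·∇` on `L²(dk)`) generates the pull-back by the flow of `X` with the half-density
(square-root-Jacobian) factor (ABG Prop. 7.6.3 (a): `(W_α u)(x) = √(det ∇ξ_α(x)) u(ξ_α(x))`,
essentially self-adjoint on smooth functions by Nelson's invariant-domain lemma), and the FIRST
COMMUTATOR with a multiplication operator is again a multiplication operator,
`i[G, A_X] = [𝒜_X, G] = X·∇G` (ABG (7.6.14): `[h(P), iA] = (F h')(P)`); for `G = Ω_{m,n}` and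
`X = ∇Ω` this is `|∇Ω|²`, positive off the critical set of `Ω` (Mourre positivity away from
thresholds, ABG §7.6.3 discussion). The requested SECOND-QUANTISED conjugate operator of a
one-phonon field `v : 𝕋 → ℝ` is the instance `X = X_v^σ`,
`X_v^σ(k, k') = ((v(k_i))_i, (σ v(k'_j))_j)` (`dGammaField v σ`, `σ = ±1` the conjugation
convention on the primed variables), i.e.
`𝒜_v^σ = Σ_i a_v^{(k_i)} + σ Σ_j a_v^{(k'_j)}`, `a_v = v ∂_k + ½ v'` (`i a_v = ½(v·i∂_k + i∂_k·v)`),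
the second quantisation `dΓ(a_v)` (Dereziński–Gérard 2022 Def. 3.21) restricted to the `(m,n)`
sector (Dereziński–Gérard 2000 §3 use exactly such `dΓ`-conjugate operators for field
Hamiltonians `dΓ(ω)`; by their Prop. 3.23, `[dΓ(ω), dΓ(a_v)] = dΓ([ω, a_v])`, which is (iii)).

## Contents (all pointwise; every identity PROVED)

* §1 `ShellPoint m n`, basis vectors `e1 i`, `e2 j`, coordinate projections `proj1`, `proj2`,
  the decomposition `p = Σ p.1 i • e1 i + Σ p.2 j • e2 j`.
* §2 For a vector field `X`: coordinate `divergence X`, `symLie X F = X·∇F + ½ (div X) F`,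
  `conjugateOp X F = i • symLie X F`; the commutator identities `symLie_mul`
  (`𝒜_X (G F) = G 𝒜_X F + (X·∇G) F`) and `mourre_commutator_conjugateOp`
  (`i (G A_X F - A_X (G F)) = (X·∇G) F`, i.e. `i[G, A_X] = X·∇G`).
* §3 The `dΓ` field `dGammaField v σ`, `secondQuantisedLie v σ = 𝒜_{X_v^σ}` and
  **`secondQuantisedConjugateOperator v σ = A_{X_v^σ} = i 𝒜_{X_v^σ}`**; PROVED: its divergence
  `Σ v'(k_i) + σ Σ v'(k'_j)` (`divergence_dGammaField`) and the particle-sum form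
  `𝒜_v^σ F = Σ_i (v(k_i) ∂_{k_i}F + ½ v'(k_i) F) + σ Σ_j (v(k'_j) ∂_{k'_j}F + ½ v'(k'_j) F)`
  (`secondQuantisedLie_eq_sum`).
* §4 The resonance function `shellFrequency ω₂ = Ω_{m,n}`, its derivative along `X`
  (`hasFDerivAt_shellFrequency`), and the requested first-commutator identity (iii):
  `i[Ω_{m,n}, A_v^σ] F = (Σ_i v(k_i)ω'(k_i) - σ Σ_j v(k'_j)ω'(k'_j)) F`
  (`shellFrequency_commutator`); for `σ = -1`, `v = ω'` the multiplier is
  `Σ_i ω'(k_i)² + Σ_j ω'(k'_j)² = |∇Ω_{m,n}|² ≥ 0`.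
* §5 The zero-momentum shells: `totalMomentum`, `zeroShell` (`Σ k_i - Σ k'_j ∈ 2πℤ`), tangency
  `IsTangentToShells X` (`Σ X_i - Σ X'_j = 0`), the tangential projection `tangentialPart X`
  (PROVED tangent), the tangency defect of the `dΓ` field
  (`totalMomentum_dGammaField = Σ v(k_i) - σ Σ v(k'_j)`), and DESCENT: for tangent `X`, `𝒜_X F`
  on the shell only depends on `F` restricted to the shell (`symLie_congr_of_isTangentToShells`).
* §6 The pull-back group with half densities at the function level:
  `secondQuantisedFlow Φ σ s`, `halfDensity Φ σ s`, `pullback Φ σ s F = √J · F ∘ Φ_s^{⊗}`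
  (`Γ` of the one-phonon `w_s f = √(Φ_s') f ∘ Φ_s`), with `pullback_zero`.

## What is NOT here (and why)

* THE SHELL CAVEAT. `dΓ(a_v)` does not commute with lattice translations (`a_v` does not
  commute with `e^{ikx}`), so it does NOT act on the zero-wavenumber fibre: on the `(m,n)` shell the
  field `X_v^σ` has normal component `Σ_i v(k_i) - σ Σ_j v(k'_j)` (`totalMomentum_dGammaField`),
  which vanishes on the `(1,1)` shell `k = k'` for `σ = 1`, on `(2,0)`/`(0,2)` for odd `v`, and NOT
  in general when `m + n ≥ 3`. Conjugate operators on `ℋ₀` are generators of flows TANGENT to the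
  shells — e.g. `tangentialPart (dGammaField v σ)` or the projected gradient of `Ω_{m,n}` — all
  covered by the general `symLie`/`conjugateOp` of §2, whose commutator identity holds for every
  `X`; the critical points of `Ω_{m,n}` ON THE SHELL (all group velocities equal) are the
  thresholds at frequency `0` the requesting crux is about.
* No Hilbert-space realisation: essential (skew/self-)adjointness on finite-particle smooth
  vectors (request (i)), unitarity and strong continuity of the pull-back group and
  `d/ds pullback = ∓𝒜 ∘ pullback` (request (ii)) live on `L²` of the shells with their Haar
  measures, i.e. on the companion `HarmonicChaosDecomposition`; once that space and its two
  unitary groups exist, `C¹`, `𝒞^{1,1}` and the Mourre estimate (request (iv)) are the predicates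
  of `ConjugateOperatorRegularity.lean` verbatim. Those predicates are over `ℂ`: at frequency `0`
  a conjugate group of a REAL orthogonal Koopman group cannot be real (`i[H, A]` would be skew on
  the real form), so `ℋ₀` must be complexified — in the chaos picture this is automatic.
* No flow is constructed from `v` (Picard–Lindelöf on `𝕋`): §6 takes the one-phonon flow `Φ` as a
  datum; group law/positivity of the Jacobian are hypotheses-free definitions with junk
  `Real.sqrt` of a negative number `= 0` documented.
* Symmetry (bosonic symmetrisation in `k` and in `k'`) is not imposed: all operators commute with
  coordinate permutations when `X` does (the `dΓ` field does), and restriction to symmetric `F` is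
  left to the Hilbert-space layer.

## References

* W. O. Amrein, A. Boutet de Monvel, V. Georgescu, *C₀-Groups, Commutator Methods and Spectral
  Theory of N-Body Hamiltonians* (1996), §7.6, eqs. (7.6.14)–(7.6.15), Prop. 7.6.3 (a).
  [AmreinBoutetdeMonvelGeorgescu1996]
* E. Mourre, Comm. Math. Phys. 78 (1981) 391–408. [Mourre1981]
* J. Dereziński, C. Gérard, *Mathematics of Quantization and Quantum Fields*, CUP 2022 ed.,
  Def. 3.21 (`dΓⁿ(h)`, `dΓ(h)`), Prop. 3.23 (`Γ(e^h) = e^{dΓ(h)}`, `[dΓ(h₁), dΓ(h₂)] = dΓ([h₁, h₂])`).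
  [DerezinskiGerard2022]
* J. Dereziński, C. Gérard, *Spectral and scattering theory of spatially cut-off `P(φ)₂`
  Hamiltonians*, Comm. Math. Phys. 213 (2000) 39–125, §3 (conjugate operators `dΓ(a)` for
  `dΓ(ω)` + interaction; the source named by the requesting route; not held, acq-03796).
  [DerezinskiGerard2000]
* J. L. van Hemmen, *Dynamics and ergodicity of the infinite harmonic crystal*, Phys. Rep. 65
  (1980) 43–149, §§3–4 (second-quantisation picture of the harmonic crystal; the source named by
  the request for the setting; not held — context only, no declaration relies on it). [VanHemmen1980]
* K. Aoki, J. Lukkarinen, H. Spohn, J. Stat. Phys. 124 (2006), §3 (the band `ω`, `ω'`).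
  [AokiLukkarinenSpohn2006]
-/

noncomputable section

open Finset
open scoped BigOperators

namespace Literature.MathematicalPhysics.KineticTheory.HarmonicChaos

open PhononBoltzmann (dispersion groupVelocity hasDerivAt_dispersion)

variable {m n : ℕ}

/-! ## §1. Shell coordinates -/

/-- **Shell coordinates** of the `(m,n)` chaos sector: `p = (k, k')` with `k : Fin m → ℝ` the
unprimed (creation) momenta and `k' : Fin n → ℝ` the primed (annihilation) momenta, real
`2π`-periodic representatives of points of `𝕋^m × 𝕋^n` (the `(m,n)`-phonon kernels of the
second-quantisation picture of the harmonic crystal, van Hemmen 1980 §§3–4). [folklore] -/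
abbrev ShellPoint (m n : ℕ) : Type := (Fin m → ℝ) × (Fin n → ℝ)

/-- The coordinate vector `∂/∂k_i`. [folklore] -/
def e1 (i : Fin m) : ShellPoint m n := (Pi.single i 1, 0)

/-- The coordinate vector `∂/∂k'_j`. [folklore] -/
def e2 (j : Fin n) : ShellPoint m n := (0, Pi.single j 1)

/-- The coordinate `p ↦ k_i` as a continuous linear form. [folklore] -/
def proj1 (i : Fin m) : ShellPoint m n →L[ℝ] ℝ :=
  (ContinuousLinearMap.proj i).comp (ContinuousLinearMap.fst ℝ (Fin m → ℝ) (Fin n → ℝ))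

/-- The coordinate `p ↦ k'_j` as a continuous linear form. [folklore] -/
def proj2 (j : Fin n) : ShellPoint m n →L[ℝ] ℝ :=
  (ContinuousLinearMap.proj j).comp (ContinuousLinearMap.snd ℝ (Fin m → ℝ) (Fin n → ℝ))

/-- `proj1 i p = k_i`. [folklore] -/
@[simp] theorem proj1_apply (i : Fin m) (p : ShellPoint m n) : proj1 i p = p.1 i := rfl

/-- `proj2 j p = k'_j`. [folklore] -/
@[simp] theorem proj2_apply (j : Fin n) (p : ShellPoint m n) : proj2 j p = p.2 j := rfl

/-- Components of `e_i`. [folklore] -/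
@[simp] theorem e1_fst (i : Fin m) : (e1 i : ShellPoint m n).1 = Pi.single i 1 := rfl

/-- Components of `e_i`. [folklore] -/
@[simp] theorem e1_snd (i : Fin m) : (e1 i : ShellPoint m n).2 = 0 := rfl

/-- Components of `e'_j`. [folklore] -/
@[simp] theorem e2_fst (j : Fin n) : (e2 j : ShellPoint m n).1 = 0 := rfl

/-- Components of `e'_j`. [folklore] -/
@[simp] theorem e2_snd (j : Fin n) : (e2 j : ShellPoint m n).2 = Pi.single j 1 := rfl

/-- `k_i(e_{i'}) = δ_{ii'}`. [folklore] -/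
theorem proj1_e1 (i i' : Fin m) : proj1 i (e1 i' : ShellPoint m n) = if i = i' then 1 else 0 := by
  simp [Pi.single_apply]

/-- `k'_j(e'_{j'}) = δ_{jj'}`. [folklore] -/
theorem proj2_e2 (j j' : Fin n) : proj2 j (e2 j' : ShellPoint m n) = if j = j' then 1 else 0 := by
  simp [Pi.single_apply]

/-- `k_i(e'_j) = 0`. [folklore] -/
@[simp] theorem proj1_e2 (i : Fin m) (j : Fin n) : proj1 i (e2 j : ShellPoint m n) = 0 := rfl

/-- `k'_j(e_i) = 0`. [folklore] -/
@[simp] theorem proj2_e1 (j : Fin n) (i : Fin m) : proj2 j (e1 i : ShellPoint m n) = 0 := rfl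

/-- Every shell vector is the sum of its coordinates times the coordinate vectors. [folklore] -/
theorem eq_sum_smul_e (p : ShellPoint m n) :
    p = (∑ i, p.1 i • (e1 i : ShellPoint m n)) + ∑ j, p.2 j • (e2 j : ShellPoint m n) := by
  ext i
  · simp [Prod.fst_sum, e1, e2, Finset.sum_apply, Pi.single_apply]
  · simp [Prod.snd_sum, e1, e2, Finset.sum_apply, Pi.single_apply]

/-! ## §2. Symmetrised Lie derivative, conjugate operator, first commutator -/

/-- The **coordinate divergence** `div X = Σ_i ∂X_i/∂k_i + Σ_j ∂X'_j/∂k'_j` of a vector field on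
the shell coordinates (`f = div F` of ABG (7.6.15); junk: Mathlib's `fderiv = 0` where a component
is not differentiable). [cite: AmreinBoutetdeMonvelGeorgescu1996, §7.6 eq. (7.6.15)] -/
def divergence (X : ShellPoint m n → ShellPoint m n) (p : ShellPoint m n) : ℝ :=
  (∑ i, fderiv ℝ (fun q => (X q).1 i) p (e1 i)) + ∑ j, fderiv ℝ (fun q => (X q).2 j) p (e2 j)

/-- **The symmetrised Lie derivative** `𝒜_X F = X·∇F + ½ (div X) F` of a function along a vector
field — the skew-symmetric part of `X·∇` on `L²(dk dk')`, `-i` times ABG's conjugate operator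
(7.6.15) in the representation where the free Hamiltonian is a multiplication operator, and the
generator of the pull-back-with-half-density group of the flow of `X` (ABG Prop. 7.6.3 (a)).
Pointwise on functions; `fderiv` junk `0` off differentiability points.
[cite: AmreinBoutetdeMonvelGeorgescu1996, §7.6 eq. (7.6.15) and Prop. 7.6.3 (a)] -/
def symLie (X : ShellPoint m n → ShellPoint m n) (F : ShellPoint m n → ℂ) (p : ShellPoint m n) :
    ℂ :=
  fderiv ℝ F p (X p) + ((divergence X p / 2 : ℝ) : ℂ) * F p

/-- **The conjugate operator of a vector field**, `A_X = ½[X·(i∇) + (i∇)·X] = i(X·∇ + ½ div X)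
= i 𝒜_X` (ABG (7.6.15) `A = ½[F(P)·Q + Q·F(P)] = F(P)·Q + (i/2) f(P)` with `Q = i∇` in the
variables where `h(P)` multiplies), formally symmetric on `L²`; pointwise on functions.
[cite: AmreinBoutetdeMonvelGeorgescu1996, §7.6 eq. (7.6.15)] -/
def conjugateOp (X : ShellPoint m n → ShellPoint m n) (F : ShellPoint m n → ℂ)
    (p : ShellPoint m n) : ℂ :=
  Complex.I * symLie X F p

/-- Unfolding `𝒜_X`. [folklore] -/
theorem symLie_apply (X : ShellPoint m n → ShellPoint m n) (F : ShellPoint m n → ℂ)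
    (p : ShellPoint m n) :
    symLie X F p = fderiv ℝ F p (X p) + ((divergence X p / 2 : ℝ) : ℂ) * F p := rfl

/-- Unfolding `A_X = i 𝒜_X`. [folklore] -/
theorem conjugateOp_apply (X : ShellPoint m n → ShellPoint m n) (F : ShellPoint m n → ℂ)
    (p : ShellPoint m n) : conjugateOp X F p = Complex.I * symLie X F p := rfl

/-- `𝒜_X` is additive in `F` (at differentiability points). [folklore] -/
theorem symLie_add (X : ShellPoint m n → ShellPoint m n) {F G : ShellPoint m n → ℂ}
    {p : ShellPoint m n} (hF : DifferentiableAt ℝ F p) (hG : DifferentiableAt ℝ G p) :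
    symLie X (fun q => F q + G q) p = symLie X F p + symLie X G p := by
  rw [symLie_apply, symLie_apply, symLie_apply, fderiv_fun_add hF hG]
  simp
  ring

/-- `𝒜_X` commutes with constant scalars. [folklore] -/
theorem symLie_const_mul (X : ShellPoint m n → ShellPoint m n) {F : ShellPoint m n → ℂ}
    {p : ShellPoint m n} (hF : DifferentiableAt ℝ F p) (c : ℂ) :
    symLie X (fun q => c * F q) p = c * symLie X F p := by
  rw [symLie_apply, symLie_apply, fderiv_const_mul hF]
  simp
  ring

/-- The derivative of a real multiplier coerced to `ℂ`. [folklore] -/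
theorem hasFDerivAt_ofReal_comp {G : ShellPoint m n → ℝ} {G' : ShellPoint m n →L[ℝ] ℝ}
    {p : ShellPoint m n} (hG : HasFDerivAt G G' p) :
    HasFDerivAt (fun q => (G q : ℂ)) (Complex.ofRealCLM.comp G') p :=
  Complex.ofRealCLM.hasFDerivAt.comp p hG

/-- **Leibniz rule for `𝒜_X` against a multiplication operator**:
`𝒜_X (G F) = G 𝒜_X F + (X·∇G) F` for a real multiplier `G` — the divergence terms cancel and only
the transport derivative of `G` survives. [cite: AmreinBoutetdeMonvelGeorgescu1996, §7.6 eq. (7.6.14)] -/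
theorem symLie_mul (X : ShellPoint m n → ShellPoint m n) {G : ShellPoint m n → ℝ}
    {F : ShellPoint m n → ℂ} {p : ShellPoint m n} (hG : DifferentiableAt ℝ G p)
    (hF : DifferentiableAt ℝ F p) :
    symLie X (fun q => (G q : ℂ) * F q) p =
      (G p : ℂ) * symLie X F p + (fderiv ℝ G p (X p) : ℂ) * F p := by
  have hGc : HasFDerivAt (fun q => (G q : ℂ)) (Complex.ofRealCLM.comp (fderiv ℝ G p)) p :=
    hasFDerivAt_ofReal_comp hG.hasFDerivAt
  have hprod : HasFDerivAt (fun q => (G q : ℂ) * F q)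
      ((G p : ℂ) • fderiv ℝ F p + F p • Complex.ofRealCLM.comp (fderiv ℝ G p)) p :=
    hGc.mul hF.hasFDerivAt
  rw [symLie_apply, symLie_apply, hprod.fderiv]
  simp
  ring

/-- **The first commutator with a multiplication operator is a multiplication operator**
(request (iii) in general form; ABG (7.6.14) `[h(P), iA] = (F·∇h)(P)`):
`i (G · A_X F - A_X (G F)) = (X·∇G) F`, i.e. `i[G, A_X] = X·∇G` pointwise, for a real multiplier
`G` and `F` differentiable at the point. [cite: AmreinBoutetdeMonvelGeorgescu1996, §7.6 eq. (7.6.14)] -/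
theorem mourre_commutator_conjugateOp (X : ShellPoint m n → ShellPoint m n)
    {G : ShellPoint m n → ℝ} {F : ShellPoint m n → ℂ} {p : ShellPoint m n}
    (hG : DifferentiableAt ℝ G p) (hF : DifferentiableAt ℝ F p) :
    Complex.I * ((G p : ℂ) * conjugateOp X F p - conjugateOp X (fun q => (G q : ℂ) * F q) p) =
      (fderiv ℝ G p (X p) : ℂ) * F p := by
  simp only [conjugateOp_apply, symLie_mul X hG hF]
  ring_nf
  rw [Complex.I_sq]
  ring

/-! ## §3. The `dΓ` field of a one-phonon vector field and the second-quantised operator -/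

/-- **The `dΓ` (second-quantisation) field** of a one-phonon vector field `v` on `𝕋` (a real
`2π`-periodic function of the momentum representative), with sign `σ` on the primed variables:
`X_v^σ(k, k') = ((v(k_i))_i, (σ v(k'_j))_j)`. For `σ = 1` this is the vector field of
`dΓ(v∂_k)` on the `(m+n)`-particle functions; `σ = -1` is the convention in which the primed
(complex-conjugate) variables are transported backwards — the vector field of Dereziński–Gérard's
`dΓⁿ(h) = Σ_j 1 ⊗ … ⊗ h ⊗ … ⊗ 1` for the one-particle field `h = v∂_k`.
[cite: DerezinskiGerard2022, Def. 3.21] -/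
def dGammaField (v : ℝ → ℝ) (σ : ℝ) (p : ShellPoint m n) : ShellPoint m n :=
  (fun i => v (p.1 i), fun j => σ * v (p.2 j))

/-- Unprimed components of the `dΓ` field. [folklore] -/
@[simp] theorem dGammaField_fst (v : ℝ → ℝ) (σ : ℝ) (p : ShellPoint m n) (i : Fin m) :
    (dGammaField v σ p).1 i = v (p.1 i) := rfl

/-- Primed components of the `dΓ` field. [folklore] -/
@[simp] theorem dGammaField_snd (v : ℝ → ℝ) (σ : ℝ) (p : ShellPoint m n) (j : Fin n) :
    (dGammaField v σ p).2 j = σ * v (p.2 j) := rfl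

/-- **The second-quantised symmetrised Lie derivative** `𝒜_v^σ = 𝒜_{X_v^σ}
= Σ_i a_v^{(k_i)} + σ Σ_j a_v^{(k'_j)}`, `a_v = v ∂_k + ½ v'` (`secondQuantisedLie_eq_sum`): the
restriction of `dΓ(a_v) = ⊕_n dΓⁿ(a_v)`, `dΓⁿ(h) = Σ_j 1 ⊗ … ⊗ h ⊗ … ⊗ 1` (Dereziński–Gérard
Def. 3.21) to `(m,n)`-particle functions, pointwise.
[cite: DerezinskiGerard2022, Def. 3.21] -/
def secondQuantisedLie (v : ℝ → ℝ) (σ : ℝ) (F : ShellPoint m n → ℂ) (p : ShellPoint m n) : ℂ :=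
  symLie (dGammaField v σ) F p

/-- **THE SECOND-QUANTISED CONJUGATE OPERATOR** `𝒜 = dΓ(a_v)` on the `(m,n)` sector, with
`a_v = ½(v(k)·i∂_k + i∂_k·v(k)) = i(v∂_k + ½v')` the symmetrised generator of the flow of `v` on
`𝕋`: `secondQuantisedConjugateOperator v σ F = i 𝒜_v^σ F = Σ_i (i a)_v^{(k_i)} F + σ Σ_j (i a)_v^{(k'_j)} F`
(pointwise on differentiable `F`; the intended `v` is `ω' = groupVelocity ω₂` or a regularisation
of `∇Ω/|∇Ω|²`; the one-phonon conjugate operator ABG (7.6.15), second-quantised by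
Dereziński–Gérard's `dΓ`, Def. 3.21; `dΓ`-conjugate operators for field Hamiltonians `dΓ(ω)` are
those of Dereziński–Gérard 2000 §3). See the module docstring for the shell caveat
(`totalMomentum_dGammaField`).
[cite: DerezinskiGerard2022, Def. 3.21] -/
def secondQuantisedConjugateOperator (v : ℝ → ℝ) (σ : ℝ) (F : ShellPoint m n → ℂ)
    (p : ShellPoint m n) : ℂ :=
  conjugateOp (dGammaField v σ) F p

/-- `A_v^σ = i 𝒜_v^σ`. [folklore] -/
theorem secondQuantisedConjugateOperator_eq (v : ℝ → ℝ) (σ : ℝ) (F : ShellPoint m n → ℂ)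
    (p : ShellPoint m n) :
    secondQuantisedConjugateOperator v σ F p = Complex.I * secondQuantisedLie v σ F p := rfl

/-- The unprimed component `q ↦ v(q_i)` of the `dΓ` field has derivative `v'(k_i) dk_i`. [folklore] -/
theorem hasFDerivAt_dGammaField_fst {v : ℝ → ℝ} (σ : ℝ) {p : ShellPoint m n} (i : Fin m)
    (hv : DifferentiableAt ℝ v (p.1 i)) :
    HasFDerivAt (fun q : ShellPoint m n => (dGammaField v σ q).1 i)
      (deriv v (p.1 i) • (proj1 i : ShellPoint m n →L[ℝ] ℝ)) p := by
  have h := hv.hasDerivAt.comp_hasFDerivAt p (proj1 i : ShellPoint m n →L[ℝ] ℝ).hasFDerivAt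
  simpa [Function.comp_def] using h

/-- The primed component `q ↦ σ v(q'_j)` of the `dΓ` field has derivative `σ v'(k'_j) dk'_j`.
[folklore] -/
theorem hasFDerivAt_dGammaField_snd {v : ℝ → ℝ} (σ : ℝ) {p : ShellPoint m n} (j : Fin n)
    (hv : DifferentiableAt ℝ v (p.2 j)) :
    HasFDerivAt (fun q : ShellPoint m n => (dGammaField v σ q).2 j)
      ((σ * deriv v (p.2 j)) • (proj2 j : ShellPoint m n →L[ℝ] ℝ)) p := by
  have h := hv.hasDerivAt.comp_hasFDerivAt p (proj2 j : ShellPoint m n →L[ℝ] ℝ).hasFDerivAt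
  have h2 := h.const_mul σ
  rw [mul_smul]
  simpa [Function.comp_def] using h2

/-- **Divergence of the `dΓ` field**: `div X_v^σ = Σ_i v'(k_i) + σ Σ_j v'(k'_j)`. [folklore] -/
theorem divergence_dGammaField {v : ℝ → ℝ} (σ : ℝ) {p : ShellPoint m n}
    (hv1 : ∀ i, DifferentiableAt ℝ v (p.1 i)) (hv2 : ∀ j, DifferentiableAt ℝ v (p.2 j)) :
    divergence (dGammaField v σ) p = (∑ i, deriv v (p.1 i)) + σ * ∑ j, deriv v (p.2 j) := by
  unfold divergence
  congr 1
  · refine Finset.sum_congr rfl fun i _ => ?_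
    rw [(hasFDerivAt_dGammaField_fst σ i (hv1 i)).fderiv]
    simp
  · rw [Finset.mul_sum]
    refine Finset.sum_congr rfl fun j _ => ?_
    rw [(hasFDerivAt_dGammaField_snd σ j (hv2 j)).fderiv]
    simp

/-- The transport term of the `dΓ` field in coordinates:
`X_v^σ·∇F = Σ_i v(k_i) ∂_{k_i}F + σ Σ_j v(k'_j) ∂_{k'_j}F`. [folklore] -/
theorem fderiv_apply_dGammaField (v : ℝ → ℝ) (σ : ℝ) (F : ShellPoint m n → ℂ)
    (p : ShellPoint m n) :
    fderiv ℝ F p (dGammaField v σ p) =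
      (∑ i, (v (p.1 i) : ℂ) * fderiv ℝ F p (e1 i)) +
        ∑ j, ((σ * v (p.2 j) : ℝ) : ℂ) * fderiv ℝ F p (e2 j) := by
  conv_lhs => rw [eq_sum_smul_e (dGammaField v σ p)]
  simp only [map_add, map_sum, ContinuousLinearMap.map_smul_of_tower, dGammaField_fst,
    dGammaField_snd, Complex.real_smul, Complex.ofReal_mul]

/-- **Particle-sum form of the second-quantised operator** (the definition the request spells
out): `𝒜_v^σ F = Σ_i (v(k_i) ∂_{k_i}F + ½ v'(k_i) F) + σ Σ_j (v(k'_j) ∂_{k'_j}F + ½ v'(k'_j) F)`,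
i.e. `Σ_i a_v^{(k_i)} + σ Σ_j a_v^{(k'_j)}` with `a_v = v∂ + ½v'` (Dereziński–Gérard Def. 3.21:
`dΓⁿ(h) = Σ_j 1 ⊗ … ⊗ h ⊗ … ⊗ 1`).
[cite: DerezinskiGerard2022, Def. 3.21] -/
theorem secondQuantisedLie_eq_sum {v : ℝ → ℝ} (σ : ℝ) (F : ShellPoint m n → ℂ)
    {p : ShellPoint m n} (hv1 : ∀ i, DifferentiableAt ℝ v (p.1 i))
    (hv2 : ∀ j, DifferentiableAt ℝ v (p.2 j)) :
    secondQuantisedLie v σ F p =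
      (∑ i, ((v (p.1 i) : ℂ) * fderiv ℝ F p (e1 i) + ((deriv v (p.1 i) / 2 : ℝ) : ℂ) * F p)) +
        ∑ j, (((σ * v (p.2 j) : ℝ) : ℂ) * fderiv ℝ F p (e2 j) +
          ((σ * deriv v (p.2 j) / 2 : ℝ) : ℂ) * F p) := by
  rw [secondQuantisedLie, symLie_apply, fderiv_apply_dGammaField,
    divergence_dGammaField σ hv1 hv2]
  have hdiv : ((((∑ i, deriv v (p.1 i)) + σ * ∑ j, deriv v (p.2 j)) / 2 : ℝ) : ℂ) * F p =
      (∑ i, ((deriv v (p.1 i) / 2 : ℝ) : ℂ) * F p) +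
        ∑ j, ((σ * deriv v (p.2 j) / 2 : ℝ) : ℂ) * F p := by
    rw [← Finset.sum_mul, ← Finset.sum_mul, ← add_mul]
    congr 1
    push_cast
    rw [add_div, Finset.sum_div, Finset.mul_sum, Finset.sum_div]
  rw [hdiv, Finset.sum_add_distrib, Finset.sum_add_distrib]
  ring

/-! ## §4. The resonance function `Ω_{m,n}` and the first commutator (iii) -/

/-- **The resonance (free-frequency) function of the `(m,n)` sector**,
`Ω_{m,n}(k, k') = Σ_i ω(k_i) - Σ_j ω(k'_j)` with the pinned band `ω = √(ω₂ + 2(1 - cos k))`: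
the free evolution of the sector is multiplication by `e^{itΩ_{m,n}}` (second quantisation of the
one-phonon dynamics `e^{itω}`); for `(m,n) = (2,2)` on the momentum shell this is ALS's energy
defect `Ω` of the 2↔2 collisions (`PhononBoltzmann.resonanceFn`, ALS06 (4.2)).
[cite: AokiLukkarinenSpohn2006, eq. (4.2)] -/
def shellFrequency (ω₂ : ℝ) (p : ShellPoint m n) : ℝ :=
  (∑ i, dispersion ω₂ (p.1 i)) - ∑ j, dispersion ω₂ (p.2 j)

/-- **`∇Ω_{m,n} = (ω'(k_i))_i ⊕ (-ω'(k'_j))_j`**: the derivative of the resonance function is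
`Σ_i ω'(k_i) dk_i - Σ_j ω'(k'_j) dk'_j` (`ω' = groupVelocity`, `ω₂ > 0`).
[cite: AokiLukkarinenSpohn2006, eq. (4.10)] -/
theorem hasFDerivAt_shellFrequency {ω₂ : ℝ} (hω : 0 < ω₂) (p : ShellPoint m n) :
    HasFDerivAt (shellFrequency (m := m) (n := n) ω₂)
      ((∑ i, groupVelocity ω₂ (p.1 i) • (proj1 i : ShellPoint m n →L[ℝ] ℝ)) -
        ∑ j, groupVelocity ω₂ (p.2 j) • (proj2 j : ShellPoint m n →L[ℝ] ℝ)) p := by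
  have h1 : ∀ i, HasFDerivAt (fun q : ShellPoint m n => dispersion ω₂ (q.1 i))
      (groupVelocity ω₂ (p.1 i) • (proj1 i : ShellPoint m n →L[ℝ] ℝ)) p := fun i => by
    have h := (hasDerivAt_dispersion hω (p.1 i)).comp_hasFDerivAt p
      (proj1 i : ShellPoint m n →L[ℝ] ℝ).hasFDerivAt
    simpa [Function.comp_def] using h
  have h2 : ∀ j, HasFDerivAt (fun q : ShellPoint m n => dispersion ω₂ (q.2 j))
      (groupVelocity ω₂ (p.2 j) • (proj2 j : ShellPoint m n →L[ℝ] ℝ)) p := fun j => by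
    have h := (hasDerivAt_dispersion hω (p.2 j)).comp_hasFDerivAt p
      (proj2 j : ShellPoint m n →L[ℝ] ℝ).hasFDerivAt
    simpa [Function.comp_def] using h
  have hs1 := HasFDerivAt.fun_sum (u := Finset.univ) fun i _ => h1 i
  have hs2 := HasFDerivAt.fun_sum (u := Finset.univ) fun j _ => h2 j
  exact hs1.sub hs2

/-- `Ω_{m,n}` is differentiable (`ω₂ > 0`). [folklore] -/
theorem differentiableAt_shellFrequency {ω₂ : ℝ} (hω : 0 < ω₂) (p : ShellPoint m n) :
    DifferentiableAt ℝ (shellFrequency (m := m) (n := n) ω₂) p :=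
  (hasFDerivAt_shellFrequency hω p).differentiableAt

/-- **The transport derivative of `Ω_{m,n}` along the `dΓ` field**:
`X_v^σ·∇Ω_{m,n} = Σ_i v(k_i) ω'(k_i) - σ Σ_j v(k'_j) ω'(k'_j)`. [folklore] -/
theorem fderiv_shellFrequency_dGammaField {ω₂ : ℝ} (hω : 0 < ω₂) (v : ℝ → ℝ) (σ : ℝ)
    (p : ShellPoint m n) :
    fderiv ℝ (shellFrequency (m := m) (n := n) ω₂) p (dGammaField v σ p) =
      (∑ i, v (p.1 i) * groupVelocity ω₂ (p.1 i)) -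
        σ * ∑ j, v (p.2 j) * groupVelocity ω₂ (p.2 j) := by
  rw [(hasFDerivAt_shellFrequency hω p).fderiv]
  simp only [Finset.mul_sum]
  simp
  congr 1
  · exact Finset.sum_congr rfl fun i _ => by ring
  · exact Finset.sum_congr rfl fun j _ => by ring

/-- **The first-commutator identity (iii)**: on every `(m,n)` sector and pointwise on
differentiable `F`,
`i[Ω_{m,n}, dΓ(a_v)^σ] F = (Σ_i v(k_i)ω'(k_i) - σ Σ_j v(k'_j)ω'(k'_j)) F`
— the commutator of the free frequency with the second-quantised conjugate operator is the
multiplication by the second quantisation of the one-phonon commutator `i[ω, a_v] = v ω'`. For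
`σ = -1` and `v = ω'` the multiplier is `Σ_i ω'(k_i)² + Σ_j ω'(k'_j)² = |∇Ω_{m,n}|² ≥ 0`, vanishing
exactly where all group velocities vanish (`k ∈ {0, π}`: the thresholds of ABG §7.6.3).
[cite: AmreinBoutetdeMonvelGeorgescu1996, §7.6 eq. (7.6.14)] -/
theorem shellFrequency_commutator {ω₂ : ℝ} (hω : 0 < ω₂) (v : ℝ → ℝ) (σ : ℝ)
    {F : ShellPoint m n → ℂ} {p : ShellPoint m n} (hF : DifferentiableAt ℝ F p) :
    Complex.I * ((shellFrequency ω₂ p : ℂ) * secondQuantisedConjugateOperator v σ F p -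
        secondQuantisedConjugateOperator v σ (fun q => (shellFrequency ω₂ q : ℂ) * F q) p) =
      (((∑ i, v (p.1 i) * groupVelocity ω₂ (p.1 i)) -
          σ * ∑ j, v (p.2 j) * groupVelocity ω₂ (p.2 j) : ℝ) : ℂ) * F p := by
  rw [secondQuantisedConjugateOperator, secondQuantisedConjugateOperator,
    mourre_commutator_conjugateOp (dGammaField v σ) (differentiableAt_shellFrequency hω p) hF,
    fderiv_shellFrequency_dGammaField hω v σ p]

/-- The Mourre multiplier for `σ = -1`, `v = ω'`: `Σ_i ω'(k_i)² + Σ_j ω'(k'_j)²` is non-negative.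
[folklore] -/
theorem mourreMultiplier_nonneg (ω₂ : ℝ) (p : ShellPoint m n) :
    0 ≤ (∑ i, groupVelocity ω₂ (p.1 i) * groupVelocity ω₂ (p.1 i)) -
      (-1) * ∑ j, groupVelocity ω₂ (p.2 j) * groupVelocity ω₂ (p.2 j) := by
  rw [neg_one_mul, sub_neg_eq_add]
  exact add_nonneg (Finset.sum_nonneg fun i _ => mul_self_nonneg _)
    (Finset.sum_nonneg fun j _ => mul_self_nonneg _)

/-! ## §5. The zero-momentum shells and tangency -/

/-- The total (lattice) momentum of a shell point, `C(k, k') = Σ_i k_i - Σ_j k'_j`; the sector of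
the zero-wavenumber space is carried by `C ∈ 2πℤ` (translation by `x` multiplies the `(m,n)`
kernel by `e^{iCx}`, and summing the covariance over `x ∈ ℤ` forces `C ≡ 0`). [folklore] -/
def totalMomentum (p : ShellPoint m n) : ℝ := (∑ i, p.1 i) - ∑ j, p.2 j

/-- `C` is additive. [folklore] -/
theorem totalMomentum_add (p q : ShellPoint m n) :
    totalMomentum (p + q) = totalMomentum p + totalMomentum q := by
  simp only [totalMomentum, Prod.fst_add, Prod.snd_add, Pi.add_apply, Finset.sum_add_distrib]
  ring

/-- `C` is homogeneous. [folklore] -/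
theorem totalMomentum_smul (c : ℝ) (p : ShellPoint m n) :
    totalMomentum (c • p) = c * totalMomentum p := by
  simp only [totalMomentum, Prod.smul_fst, Prod.smul_snd, Pi.smul_apply, smul_eq_mul,
    ← Finset.mul_sum]
  ring

/-- **The zero-total-momentum shells** (lifted): `{(k, k') | Σ_i k_i - Σ_j k'_j ∈ 2πℤ}`, the union
of the affine hyperplanes covering the closed subgroup `Σ k_i - Σ k'_j = 0` of `𝕋^m × 𝕋^n` (the
momentum shell of ALS's collision operator for `(m,n) = (2,2)`). [folklore] -/
def zeroShell (m n : ℕ) : Set (ShellPoint m n) :=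
  {p | ∃ ℓ : ℤ, totalMomentum p = 2 * Real.pi * ℓ}

/-- Membership in the zero shell. [folklore] -/
theorem mem_zeroShell_iff (p : ShellPoint m n) :
    p ∈ zeroShell m n ↔ ∃ ℓ : ℤ, totalMomentum p = 2 * Real.pi * ℓ := Iff.rfl

/-- **Tangency to the shells**: `X` is tangent to every level set of the total momentum iff its
normal component `X·∇C = C(X) = Σ_i X_i - Σ_j X'_j` vanishes identically. Only tangent fields
generate flows preserving the zero-momentum shells, i.e. operators on the zero-wavenumber fibre.
[folklore] -/
def IsTangentToShells (X : ShellPoint m n → ShellPoint m n) : Prop :=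
  ∀ p, totalMomentum (X p) = 0

/-- **The tangency defect of the `dΓ` field**: `C(X_v^σ(k, k')) = Σ_i v(k_i) - σ Σ_j v(k'_j)`. It
vanishes on the `(1,1)` shell `k = k'` when `σ = 1`, but not in general for `m + n ≥ 3`: `dΓ(a_v)`
does not preserve the zero-momentum shells (it does not commute with lattice translations).
[folklore] -/
theorem totalMomentum_dGammaField (v : ℝ → ℝ) (σ : ℝ) (p : ShellPoint m n) :
    totalMomentum (dGammaField v σ p) = (∑ i, v (p.1 i)) - σ * ∑ j, v (p.2 j) := by
  simp [totalMomentum, dGammaField, Finset.mul_sum]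

/-- On the `(1,1)` shell `k = k'` the `dΓ` field with `σ = 1` is tangent. [folklore] -/
theorem totalMomentum_dGammaField_one_one (v : ℝ → ℝ) (p : ShellPoint 1 1)
    (hp : p.1 0 = p.2 0) : totalMomentum (dGammaField v 1 p) = 0 := by
  simp [totalMomentum_dGammaField, hp]

/-- The constant normal field `∇C = ((1)_i, (-1)_j)` of the shells. [folklore] -/
def shellNormal (m n : ℕ) : ShellPoint m n := (fun _ => 1, fun _ => -1)

/-- `C(∇C) = m + n`. [folklore] -/
theorem totalMomentum_shellNormal : totalMomentum (shellNormal m n) = m + n := by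
  simp [totalMomentum, shellNormal]

/-- **The tangential projection** of a vector field onto the shells,
`X_T = X - (C(X)/(m+n)) ∇C` (orthogonal projection for the Euclidean structure of the coordinates);
for `X = ∇Ω_{m,n}` this is the shell gradient whose zeros — all group velocities equal — are the
frequency-`0` thresholds. Junk-free: for `m + n = 0` the space is a point. [folklore] -/
def tangentialPart (X : ShellPoint m n → ShellPoint m n) (p : ShellPoint m n) : ShellPoint m n :=
  X p - (totalMomentum (X p) / (m + n : ℝ)) • shellNormal m n

/-- The tangential projection is tangent to the shells. [folklore] -/
theorem isTangentToShells_tangentialPart (X : ShellPoint m n → ShellPoint m n) :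
    IsTangentToShells (tangentialPart X) := by
  intro p
  rw [tangentialPart, sub_eq_add_neg, ← neg_smul, totalMomentum_add, totalMomentum_smul,
    totalMomentum_shellNormal]
  rcases Nat.eq_zero_or_pos (m + n) with h | h
  · obtain ⟨hm, hn⟩ := Nat.add_eq_zero_iff.1 h
    subst hm; subst hn
    simp [totalMomentum]
  · have hmn : (m + n : ℝ) ≠ 0 := by exact_mod_cast h.ne'
    field_simp
    ring

/-- A tangent field is unchanged by the tangential projection. [folklore] -/
theorem tangentialPart_eq_self {X : ShellPoint m n → ShellPoint m n} (hX : IsTangentToShells X)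
    (p : ShellPoint m n) : tangentialPart X p = X p := by
  simp [tangentialPart, hX p]

/-- Lines along a tangent field stay in the zero shell. [folklore] -/
theorem add_smul_mem_zeroShell {X : ShellPoint m n → ShellPoint m n} (hX : IsTangentToShells X)
    {p : ShellPoint m n} (hp : p ∈ zeroShell m n) (t : ℝ) : p + t • X p ∈ zeroShell m n := by
  obtain ⟨ℓ, hℓ⟩ := hp
  exact ⟨ℓ, by rw [totalMomentum_add, totalMomentum_smul, hX p, mul_zero, add_zero, hℓ]⟩

/-- **Descent to the shell**: for a field tangent to the shells, `𝒜_X F` at a shell point only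
depends on the restriction of `F` to the zero shell — two differentiable functions agreeing on
the shell have the same symmetrised Lie derivative there. (For non-tangent `X`, e.g. the `dΓ`
field on `m + n ≥ 3`, this fails.) [folklore] -/
theorem symLie_congr_of_isTangentToShells {X : ShellPoint m n → ShellPoint m n}
    (hX : IsTangentToShells X) {F G : ShellPoint m n → ℂ} {p : ShellPoint m n}
    (hp : p ∈ zeroShell m n) (hFG : ∀ q ∈ zeroShell m n, F q = G q)
    (hF : DifferentiableAt ℝ F p) (hG : DifferentiableAt ℝ G p) :
    symLie X F p = symLie X G p := by
  have h0 : F p = G p := hFG p hp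
  -- the directional derivatives along `X p` agree: restrict to the line `t ↦ p + t • X p ⊆ shell`
  have hline : HasDerivAt (fun t : ℝ => p + t • X p) (X p) 0 := by
    simpa using ((hasDerivAt_id (0 : ℝ)).smul_const (X p)).const_add p
  have hF' : HasDerivAt (fun t : ℝ => F (p + t • X p)) (fderiv ℝ F p (X p)) 0 := by
    have h : HasFDerivAt F (fderiv ℝ F p) (p + (0 : ℝ) • X p) := by
      simpa using hF.hasFDerivAt
    exact h.comp_hasDerivAt 0 hline
  have hG' : HasDerivAt (fun t : ℝ => G (p + t • X p)) (fderiv ℝ G p (X p)) 0 := by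
    have h : HasFDerivAt G (fderiv ℝ G p) (p + (0 : ℝ) • X p) := by
      simpa using hG.hasFDerivAt
    exact h.comp_hasDerivAt 0 hline
  have heq : (fun t : ℝ => F (p + t • X p)) = fun t : ℝ => G (p + t • X p) :=
    funext fun t => hFG _ (add_smul_mem_zeroShell hX hp t)
  rw [heq] at hF'
  have hd : fderiv ℝ F p (X p) = fderiv ℝ G p (X p) := hF'.unique hG'
  rw [symLie_apply, symLie_apply, hd, h0]

/-! ## §6. The pull-back group with half densities (function level) -/

/-- **The second-quantised one-phonon flow** on shell coordinates: given a one-phonon flow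
`Φ : ℝ → 𝕋 → 𝕋` (lifted, `Φ s` acting on representatives), unprimed momenta move by `Φ_s` and
primed ones by `Φ_{σs}`. [cite: AmreinBoutetdeMonvelGeorgescu1996, Prop. 7.6.3 (a)] -/
def secondQuantisedFlow (Φ : ℝ → ℝ → ℝ) (σ s : ℝ) (p : ShellPoint m n) : ShellPoint m n :=
  (fun i => Φ s (p.1 i), fun j => Φ (σ * s) (p.2 j))

/-- **The half-density (square-root Jacobian) factor** of the second-quantised flow,
`J_s(k, k')^{1/2} = Π_i √(∂_k Φ_s(k_i)) Π_j √(∂_k Φ_{σs}(k'_j))` (ABG Prop. 7.6.3 (a): `√η_α`).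
Junk: `Real.sqrt = 0` on negative numbers, `deriv = 0` off differentiability.
[cite: AmreinBoutetdeMonvelGeorgescu1996, Prop. 7.6.3 (a)] -/
def halfDensity (Φ : ℝ → ℝ → ℝ) (σ s : ℝ) (p : ShellPoint m n) : ℝ :=
  (∏ i, Real.sqrt (deriv (Φ s) (p.1 i))) * ∏ j, Real.sqrt (deriv (Φ (σ * s)) (p.2 j))

/-- **The pull-back with half densities** `(W_s F)(k, k') = J_s^{1/2}(k, k') F(Φ_s^{⊗}(k, k'))`
— the second quantisation `Γ(w_s)` of the one-phonon unitary `(w_s f)(k) = √(Φ_s'(k)) f(Φ_s k)`,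
which for the flow `Φ` of `∓v` is the unitary group `e^{± is A_v}` of the conjugate operator
(ABG Prop. 7.6.3 (a) for the one-phonon group; `Γ(e^{h}) = e^{dΓ(h)}`, Dereziński–Gérard
Prop. 3.23; request (ii)), here at the level of functions.
[cite: AmreinBoutetdeMonvelGeorgescu1996, Prop. 7.6.3 (a)] -/
def pullback (Φ : ℝ → ℝ → ℝ) (σ s : ℝ) (F : ShellPoint m n → ℂ) (p : ShellPoint m n) : ℂ :=
  (halfDensity Φ σ s p : ℂ) * F (secondQuantisedFlow Φ σ s p)

/-- At `s = 0` the second-quantised flow is the identity when `Φ_0 = id`. [folklore] -/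
theorem secondQuantisedFlow_zero {Φ : ℝ → ℝ → ℝ} (hΦ : Φ 0 = id) (σ : ℝ) (p : ShellPoint m n) :
    secondQuantisedFlow Φ σ 0 p = p := by
  ext <;> simp [secondQuantisedFlow, hΦ]

/-- At `s = 0` the half density is `1` when `Φ_0 = id`. [folklore] -/
theorem halfDensity_zero {Φ : ℝ → ℝ → ℝ} (hΦ : Φ 0 = id) (σ : ℝ) (p : ShellPoint m n) :
    halfDensity Φ σ 0 p = 1 := by
  simp [halfDensity, hΦ]

/-- `W_0 = id` when `Φ_0 = id`. [folklore] -/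
theorem pullback_zero {Φ : ℝ → ℝ → ℝ} (hΦ : Φ 0 = id) (σ : ℝ) (F : ShellPoint m n → ℂ) :
    pullback Φ σ 0 F = F := by
  funext p
  simp [pullback, halfDensity_zero hΦ, secondQuantisedFlow_zero hΦ]

/-- The pull-back is linear in `F`. [folklore] -/
theorem pullback_add (Φ : ℝ → ℝ → ℝ) (σ s : ℝ) (F G : ShellPoint m n → ℂ) :
    pullback Φ σ s (F + G) = pullback Φ σ s F + pullback Φ σ s G := by
  funext p
  simp [pullback, mul_add]

end Literature.MathematicalPhysics.KineticTheory.HarmonicChaos
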